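import Mathlib
import Literature.Analysis.FluidPDE.SobolevWholeSpace
import Literature.Analysis.FluidPDE.BKMClassGradientContinuity
import Literature.Analysis.FluidPDE.TaoEnstrophyLocalisation
import Literature.Analysis.FluidPDE.TaoEnstrophyLocalisationProofs
import Summits.NavierStokesRegularity.NavierStokesRegularity.Theorems.StretchingWellBindingEnstrophyQuarterLawEnstrophyScale
import Summits.NavierStokesRegularity.NavierStokesRegularity.Theorems.StretchingWellBindingEnstrophyQuarterLawSparsenessTools
import HarnessLib

/-!
# Shelf crux `EnstrophyQuarterLaw` (stmt-NavierStokesRegularity-1574), line «sparse_sieve»: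
# the ENSTROPHY COUNT for stub S2 — at most `C₀ (r · Z(t))³ / ε₀⁶` separated `ε₀`-concentrating balls
# at scale `r` (unconditional, every first blow-up, every time; sharp for general divergence-free fields)

Helper file (`--supports stmt-NavierStokesRegularity-1574 --as helper`) for the OPEN registered stub
`stub_uniformSparseness` (S2). Sequel to `…EnstrophyQuarterLawEnstrophyScale` (the threshold form: count `0` when
`r · Z(t) ≤ c₀ ε₀²`). Here the COUNTING form, with `Z(t) = ∫ |curl u(t)|²`:

* `lintegral_enorm_pow_six_le` (static): `∫ ‖v‖⁶ ≤ K⁶ (∫ ‖curl v‖²)³` for divergence-free `C²` fields with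
  `v, Dv, D²v ∈ L²` (`H¹ ⊂ L⁶`, `‖Dv‖_op ≤ |Dv|_F`, Dirichlet = enstrophy);
* `ofReal_pow_six_le_volume_mul_setLIntegral` (static): an `ε₀`-concentrating ball pays an `L⁶` quantum,
  `ε₀⁶ ≤ |B| · ∫_B ‖v‖⁶` (Cauchy–Schwarz on the ball);
* `card_le_enstrophy_count`: there is an ABSOLUTE `C₀` such that along every maximal classical solution on
  `[0,T)`, Leray–Hopf from a rapidly decaying datum, for every `ε₀ > 0`, `t ∈ [0,T)`, `r > 0` and every
  `4r`-separated finite family `F` of centres whose balls `B(x,2r)` carry `∫ |u(t)|³ ≥ ε₀³`: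
  `card F ≤ C₀ · (r · Z(t))³ / ε₀⁶` (`C₀ = 512 |B₁| K⁶`; the balls overlap at most `8`-fold by
  `SparsenessTools.sum_setLIntegral_ball_le_of_separated`).

READING (census currency). The registered S2 asks for a bound `N₀(ε₀)` uniform in `(t, r)`; this file gives the
unconditional bound `C₀ (r Z(t))³/ε₀⁶`, so S2 holds with room wherever `r · Z(t)` stays bounded — under the crux
(`Z ≤ K'/√(T−t)`) at all parabolic-and-finer scales `r ≲ √(T−t)`, unconditionally at scales `r ≲ 1/Z(t)`. The
bound is SHARP for general finite-energy divergence-free fields (a uniform-flow blob of amplitude `ε₀/r` and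
radius `R = Z r²/ε₀²` carries `≍ (R/r)³ = (rZ)³/ε₀⁶` concentrating balls), so any improvement in the regime
`r Z(t) → ∞` must use the Navier–Stokes dynamics — that regime, `1/Z(t) ≪ r < r_min` as `t → T`, is exactly where
S2 is OPEN. HONEST FRAMING: elementary unconditional bookkeeping along a HYPOTHETICAL blow-up; S2, the crux
`EnstrophyQuarterLaw` (1574) and Navier–Stokes regularity stay OPEN; no summit statement is proved.
-/

noncomputable section

-- the summit and its single sub-problem share the name (CONVENTIONS §1), as in every Theorems file
set_option linter.dupNamespace false

namespace Summit.NavierStokesRegularity.NavierStokesRegularity.Theorems.EnstrophyQuarterLaw.EnstrophyScale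

open MeasureTheory Set Metric Module
open Literature.Analysis Literature.Analysis.FluidPDE
open scoped ENNReal NNReal

/-! ### Static pieces -/

/-- **`∫ ‖v‖⁶ ≤ K⁶ (∫ ‖curl v‖²)³`** for a divergence-free `C²` field `v : ℝ³ → ℝ³` with `v, Dv, D²v ∈ L²`
(`K = SNormLESNormFDerivOfEqConst ℝ³ volume 2`: the embedding `‖v‖₆ ≤ K‖Dv‖₂`, `‖Dv‖_op² ≤ |Dv|_F²` pointwise,
and `∫ |Dv|_F² = ∫ ‖curl v‖²`). [folklore] -/
theorem lintegral_enorm_pow_six_le {v : EuclideanSpace ℝ (Fin 3) → EuclideanSpace ℝ (Fin 3)}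
    (hv : ContDiff ℝ 2 v) (hdiv : VectorCalculus.IsDivFree v) (h0 : ∫⁻ x, ‖v x‖ₑ ^ 2 < ⊤)
    (h1 : ∫⁻ x, ‖iteratedFDeriv ℝ 1 v x‖ₑ ^ 2 < ⊤) (h2 : ∫⁻ x, ‖iteratedFDeriv ℝ 2 v x‖ₑ ^ 2 < ⊤) :
    ∫⁻ y, ‖v y‖ₑ ^ 6 ≤
      (SNormLESNormFDerivOfEqConst (EuclideanSpace ℝ (Fin 3)) (volume : Measure (EuclideanSpace ℝ (Fin 3))) 2 : ℝ≥0∞) ^ 6 *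
        (∫⁻ y, ‖curl v y‖ₑ ^ 2) ^ 3 := by
  have hv1 : ContDiff ℝ 1 v := hv.of_le (by norm_cast)
  have h2v : eLpNorm v 2 volume < ⊤ := by
    rw [eLpNorm_eq_lintegral_rpow_enorm_toReal (by norm_num) (by norm_num)]
    refine ENNReal.rpow_lt_top_of_nonneg (by norm_num) (ne_of_lt ?_)
    have : ∫⁻ y, ‖v y‖ₑ ^ ((2 : ℝ≥0∞).toReal) = ∫⁻ y, ‖v y‖ₑ ^ 2 := by
      refine lintegral_congr fun y => ?_
      rw [ENNReal.toReal_ofNat, ENNReal.rpow_two]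
    rw [this]; exact h0
  have hSob := eLpNorm_six_le_eLpNorm_fderiv_two (volume : Measure (EuclideanSpace ℝ (Fin 3)))
    finrank_euclideanSpace_fin hv1 h2v
  have hD : eLpNorm (fderiv ℝ v) 2 volume ≤ (∫⁻ y, ‖curl v y‖ₑ ^ 2) ^ (1 / 2 : ℝ) := by
    rw [eLpNorm_eq_lintegral_rpow_enorm_toReal (by norm_num) (by norm_num), ENNReal.toReal_ofNat]
    refine ENNReal.rpow_le_rpow ?_ (by norm_num)
    rw [← lintegral_frobeniusNormSq_fderiv_eq_lintegral_curl_sq hv hdiv h0 h1 h2]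
    refine lintegral_mono fun y => ?_
    rw [ENNReal.rpow_two, ← ofReal_norm, ← ENNReal.ofReal_pow (norm_nonneg _)]
    exact ENNReal.ofReal_le_ofReal (sq_opNorm_le_frobeniusNormSq _)
  have h6eq : ∫⁻ y, ‖v y‖ₑ ^ 6 = eLpNorm v 6 volume ^ (6 : ℝ) := by
    rw [eLpNorm_eq_lintegral_rpow_enorm_toReal (by norm_num) (by norm_num), ENNReal.toReal_ofNat,
      ← ENNReal.rpow_mul]
    norm_num
  rw [h6eq]
  calc eLpNorm v 6 volume ^ (6 : ℝ)
      ≤ ((SNormLESNormFDerivOfEqConst (EuclideanSpace ℝ (Fin 3)) (volume : Measure (EuclideanSpace ℝ (Fin 3))) 2 : ℝ≥0∞) *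
          (∫⁻ y, ‖curl v y‖ₑ ^ 2) ^ (1 / 2 : ℝ)) ^ (6 : ℝ) :=
        ENNReal.rpow_le_rpow (hSob.trans (mul_le_mul' le_rfl hD)) (by norm_num)
    _ = (SNormLESNormFDerivOfEqConst (EuclideanSpace ℝ (Fin 3)) (volume : Measure (EuclideanSpace ℝ (Fin 3))) 2 : ℝ≥0∞) ^ 6 *
          (∫⁻ y, ‖curl v y‖ₑ ^ 2) ^ 3 := by
        rw [ENNReal.mul_rpow_of_nonneg _ _ (by norm_num), ← ENNReal.rpow_mul,
          show (6 : ℝ) = ((6 : ℕ) : ℝ) by norm_num, ENNReal.rpow_natCast,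
          show (1 / 2 * ((6 : ℕ) : ℝ) : ℝ) = ((3 : ℕ) : ℝ) by norm_num, ENNReal.rpow_natCast]

/-- **An `ε₀`-concentrating ball pays an `L⁶` quantum:** if `ε₀³ ≤ ∫_B ‖v‖³` (as `ofReal (ε₀³) ≤ ∫⁻_B ‖v‖ₑ³`)
on a measurable-enough set `B` (any set, for the restricted measure), then `ε₀⁶ ≤ |B| · ∫_B ‖v‖⁶`
(Cauchy–Schwarz `∫_B ‖v‖³ · 1 ≤ (∫_B ‖v‖⁶)^{1/2} |B|^{1/2}`, squared). [folklore] -/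
theorem ofReal_pow_six_le_volume_mul_setLIntegral {v : EuclideanSpace ℝ (Fin 3) → EuclideanSpace ℝ (Fin 3)}
    (hv : Continuous v) (B : Set (EuclideanSpace ℝ (Fin 3))) {ε₀ : ℝ} (hε₀ : 0 ≤ ε₀)
    (hconc : ENNReal.ofReal (ε₀ ^ 3) ≤ ∫⁻ y in B, ‖v y‖ₑ ^ 3) :
    ENNReal.ofReal (ε₀ ^ 6) ≤ volume B * ∫⁻ y in B, ‖v y‖ₑ ^ 6 := by
  have hvm : AEMeasurable (fun y => ‖v y‖ₑ ^ 3) (volume.restrict B) :=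
    (hv.measurable.enorm.pow_const 3).aemeasurable
  have hH := ENNReal.lintegral_mul_le_Lp_mul_Lq (volume.restrict B)
    Real.HolderConjugate.two_two hvm (g := fun _ => (1 : ℝ≥0∞)) aemeasurable_const
  have hfg : (fun y => ‖v y‖ₑ ^ 3) * (fun _ => (1 : ℝ≥0∞)) = fun y => ‖v y‖ₑ ^ 3 := by
    funext y; simp
  rw [hfg] at hH
  have hone : (∫⁻ _ in B, (1 : ℝ≥0∞) ^ (2 : ℝ)) ^ (1 / (2 : ℝ)) = volume B ^ (1 / 2 : ℝ) := by simp
  have hsix : ∫⁻ y in B, (‖v y‖ₑ ^ 3) ^ (2 : ℝ) = ∫⁻ y in B, ‖v y‖ₑ ^ 6 := by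
    refine lintegral_congr fun y => ?_
    rw [ENNReal.rpow_two, ← pow_mul]
  rw [hone, hsix] at hH
  -- square `ofReal (ε₀³) ≤ (∫_B ‖v‖⁶)^{1/2} |B|^{1/2}`
  have hsq := pow_le_pow_left' (hconc.trans hH) 2
  rw [← ENNReal.ofReal_pow (by positivity), ← pow_mul, show (3 * 2 : ℕ) = 6 by norm_num, mul_pow,
    ← ENNReal.rpow_two, ← ENNReal.rpow_two, ← ENNReal.rpow_mul, ← ENNReal.rpow_mul] at hsq
  norm_num at hsq
  rw [mul_comm] at hsq
  exact hsq

/-! ### The enstrophy count along a first blow-up -/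

/-- **THE ENSTROPHY COUNT (unconditional).** There is an absolute `C₀ > 0` such that for every `ν, T > 0`,
every maximal classical solution `u` on `[0,T)` that is Leray–Hopf from its rapidly decaying datum, every
`ε₀ > 0`, `t ∈ [0,T)`, `r > 0` and every finite family `F ⊆ ℝ³` of `4r`-separated centres whose balls
`B(x, 2r)` each carry `∫ |u(t)|³ ≥ ε₀³` — exactly the families counted by the registered stub
`stub_uniformSparseness` (S2) —
`card F ≤ C₀ · (r · Z(t))³ / ε₀⁶`, `Z(t) = ∫ |curl u(t)|²` (`C₀ = 512 |B₁| K⁶`). Each ball pays the `L⁶`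
quantum `ε₀⁶/|B(·,2r)|`, the balls overlap `≤ 8`-fold, and `∫ ‖u(t)‖⁶ ≤ K⁶ Z(t)³`. [folklore] -/
theorem card_le_enstrophy_count :
    ∃ C₀ : ℝ, 0 < C₀ ∧ ∀ (ν T : ℝ), 0 < ν → 0 < T →
      ∀ (u : ℝ → EuclideanSpace ℝ (Fin 3) → EuclideanSpace ℝ (Fin 3))
        (p : ℝ → EuclideanSpace ℝ (Fin 3) → ℝ),
      IsMaximalSmoothSolution ν 0 u p T → IsLerayHopfOn T ν 0 (u 0) u →
      HasRapidSpatialDecay (u 0) →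
      ∀ ε₀ : ℝ, 0 < ε₀ → ∀ t ∈ Set.Ico 0 T, ∀ r : ℝ, 0 < r →
        ∀ F : Finset (EuclideanSpace ℝ (Fin 3)),
          (∀ x ∈ F, ∀ y ∈ F, x ≠ y → 4 * r ≤ dist x y) →
          (∀ x ∈ F, ENNReal.ofReal (ε₀ ^ 3) ≤ ∫⁻ y in Metric.ball x (2 * r), ‖u t y‖ₑ ^ 3) →
          (F.card : ℝ) ≤ C₀ * (r * (∫⁻ y, ‖curl (u t) y‖ₑ ^ 2).toReal) ^ 3 / ε₀ ^ 6 := by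
  -- the absolute constants
  set Kₑ : ℝ≥0∞ := (SNormLESNormFDerivOfEqConst (EuclideanSpace ℝ (Fin 3))
    (volume : Measure (EuclideanSpace ℝ (Fin 3))) 2 : ℝ≥0∞) with hKₑ
  set V₁ : ℝ≥0∞ := volume (ball (0 : EuclideanSpace ℝ (Fin 3)) 1) with hV₁
  have hV₁top : V₁ ≠ ⊤ := measure_ball_lt_top.ne
  set M : ℝ≥0∞ := ENNReal.ofReal 8 * (ENNReal.ofReal 8 * V₁) * Kₑ ^ 6 with hM
  have hMtop : M ≠ ⊤ :=
    ENNReal.mul_ne_top (ENNReal.mul_ne_top ENNReal.ofReal_ne_top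
      (ENNReal.mul_ne_top ENNReal.ofReal_ne_top hV₁top)) (ENNReal.pow_ne_top ENNReal.coe_ne_top)
  set Mr : ℝ := M.toReal with hMr
  have hMr0 : 0 ≤ Mr := ENNReal.toReal_nonneg
  refine ⟨Mr + 1, by positivity, ?_⟩
  intro ν T hν hT u p hmax hLH hdec ε₀ hε₀ t ht r hr F hsep hconc
  have hcl : IsClassicalNSSolutionOn (Ico 0 T) ν 0 u p := hmax.1
  -- slice data
  have hn := lintegral_iteratedFDeriv_sq_lt_top hν hcl hLH hdec ht
  have hv : ContDiff ℝ 2 (u t) := (hcl.contDiff_velocity ht).of_le (by norm_cast)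
  have h0 : ∫⁻ y, ‖u t y‖ₑ ^ 2 < ⊤ := by
    refine lt_of_le_of_lt (le_of_eq (lintegral_congr fun y => ?_)) (hn 0)
    rw [← ofReal_norm, ← norm_iteratedFDeriv_zero (𝕜 := ℝ) (f := u t), ofReal_norm]
  set Z : ℝ≥0∞ := ∫⁻ y, ‖curl (u t) y‖ₑ ^ 2 with hZ
  have hZtop : Z ≠ ⊤ :=
    (lt_of_le_of_lt (lintegral_curl_sq_le (u t)) (ENNReal.mul_lt_top ENNReal.ofReal_lt_top (hn 1))).ne
  -- the `L⁶` budget and the bounded overlap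
  have h6 := lintegral_enorm_pow_six_le hv (hcl.divFree t ht) h0 (hn 1) (hn 2)
  have hover := SparsenessTools.sum_setLIntegral_ball_le_of_separated (s := 4 * r) (ρ := 2 * r)
    (by positivity) (by positivity) F hsep
    (g := fun y => ‖u t y‖ₑ ^ 6) (hv.continuous.measurable.enorm.pow_const 6).aemeasurable
  have h8 : ENNReal.ofReal (((2 * r + 4 * r / 2) / (4 * r / 2)) ^ 3) = ENNReal.ofReal 8 := by
    congr 1; field_simp; norm_num
  rw [h8] at hover
  -- the volume of the balls
  have hvol : ∀ x : EuclideanSpace ℝ (Fin 3),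
      volume (ball x (2 * r)) = ENNReal.ofReal 8 * ENNReal.ofReal r ^ 3 * V₁ := fun x => by
    rw [Measure.addHaar_ball_of_pos _ _ (by positivity : (0 : ℝ) < 2 * r), finrank_euclideanSpace_fin,
      show (2 * r) ^ 3 = 8 * r ^ 3 by ring, ENNReal.ofReal_mul (by norm_num),
      ENNReal.ofReal_pow hr.le]
  -- each ball pays the quantum
  have hquant : ∀ x ∈ F, ENNReal.ofReal (ε₀ ^ 6) ≤
      (ENNReal.ofReal 8 * ENNReal.ofReal r ^ 3 * V₁) * ∫⁻ y in ball x (2 * r), ‖u t y‖ₑ ^ 6 := by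
    intro x hx
    rw [← hvol x]
    exact ofReal_pow_six_le_volume_mul_setLIntegral hv.continuous _ hε₀.le (hconc x hx)
  -- sum over the family
  have hsum : (F.card : ℝ≥0∞) * ENNReal.ofReal (ε₀ ^ 6) ≤ M * (ENNReal.ofReal r ^ 3 * Z ^ 3) := by
    calc (F.card : ℝ≥0∞) * ENNReal.ofReal (ε₀ ^ 6)
        = ∑ x ∈ F, ENNReal.ofReal (ε₀ ^ 6) := by rw [Finset.sum_const, nsmul_eq_mul]
      _ ≤ ∑ x ∈ F, (ENNReal.ofReal 8 * ENNReal.ofReal r ^ 3 * V₁) *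
            ∫⁻ y in ball x (2 * r), ‖u t y‖ₑ ^ 6 := Finset.sum_le_sum hquant
      _ = (ENNReal.ofReal 8 * ENNReal.ofReal r ^ 3 * V₁) *
            ∑ x ∈ F, ∫⁻ y in ball x (2 * r), ‖u t y‖ₑ ^ 6 := by rw [Finset.mul_sum]
      _ ≤ (ENNReal.ofReal 8 * ENNReal.ofReal r ^ 3 * V₁) *
            (ENNReal.ofReal 8 * (Kₑ ^ 6 * Z ^ 3)) := by
          gcongr
          exact hover.trans (mul_le_mul' le_rfl h6)
      _ = M * (ENNReal.ofReal r ^ 3 * Z ^ 3) := by rw [hM]; ring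
  -- back to real numbers
  have hfin : M * (ENNReal.ofReal r ^ 3 * Z ^ 3) = ENNReal.ofReal (Mr * (r * Z.toReal) ^ 3) := by
    rw [ENNReal.ofReal_mul hMr0, hMr, ENNReal.ofReal_toReal hMtop, mul_pow,
      ENNReal.ofReal_mul (by positivity), ENNReal.ofReal_pow hr.le, ENNReal.ofReal_pow ENNReal.toReal_nonneg,
      ENNReal.ofReal_toReal hZtop]
  rw [hfin, ← ENNReal.ofReal_natCast, ← ENNReal.ofReal_mul (Nat.cast_nonneg _),
    ENNReal.ofReal_le_ofReal_iff (by positivity)] at hsum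
  have hε6 : 0 < ε₀ ^ 6 := by positivity
  rw [le_div_iff₀ hε6]
  calc (F.card : ℝ) * ε₀ ^ 6 ≤ Mr * (r * Z.toReal) ^ 3 := hsum
    _ ≤ (Mr + 1) * (r * Z.toReal) ^ 3 := by gcongr; linarith

end Summit.NavierStokesRegularity.NavierStokesRegularity.Theorems.EnstrophyQuarterLaw.EnstrophyScale

end
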